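import Summits.PneNP.PneNP.Theorems.UniformStreamUniformStreamLBStubStreamLoopRun
import HarnessLib

/-!
# The streaming loop machine, III: phases and rounds

Route `UniformStream`, crux `UniformStreamLB` (stmt-PneNP-16045), line `birth`, stub `stub_streamLoop`
(`--supports stmt-PneNP-16045`), continuing `UniformStreamUniformStreamLBStubStreamLoopRun.lean`. In
the form "a run through a predicate `P` within a step budget" (local notation
`RunsIn⟪C, f, P, a, b, m⟫ = SpaceLoop.RunsVia f P a b ∧ TM2Iter.ReachesIn f a b m`) this file proves
for the streaming loop machine `StreamLoop.streamTM M`: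

* the phases `feed_runs` (pour `TMP` onto the input stack of `M`, push the tag word; `|TMP| + 1`
  steps), `mv_runs` (pour the output of `M` onto `TMP`), `rew_runs` (rewind the read-only head),
  `embM_runs` (an `n`-step run of `M` is an `n`-step run of the loop machine on embedded
  configurations);
* the rounds: `round_runs` — in a phase `p ≠ accept`, with payload `w` reversed on `TMP`, feed `M` the
  word `p.tags ++ w`; if `M` maps it to `w'` in `n` steps the machine arrives at `p.next` with `w'`
  reversed on `TMP`, within `|w| + |w'| + n + 3` steps; `accept_runs` — the accepting round halts
  with the verdict on `inl M.k₁` (Arora–Barak 2009, §4.1: the space of one round is reused);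
* on the data of the stub: `gd_run` (a `B N`-step run of `M` on a word of length `≤ B N + 3` stays in
  work space `Wb`, `SpaceLoop.stkLen_le_of_iterate`, Arora–Barak 2009, Thm. 4.2), one counting round
  (`count_round`, `≤ 3 B N + 4` steps) and the counting phase (`count_phase`), through good
  configurations (local notation `Gd⟪M, W, x⟫`: work space `≤ W`, `reverse LEFT ++ IN = x`).

## References

* S. Arora, B. Barak, *Computational Complexity: A Modern Approach*, CUP 2009, Def. 4.1 (space
  bounded computation, read-only input), §4.1 (space is reused), Thm. 4.2, Def. 5.10 (TISP).
  [AroraBarak2009]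
* Mathlib, `Mathlib/Computability/TuringMachine/Computable.lean` (`FinTM2`, `initList`, `haltList`).
-/

set_option linter.dupNamespace false

noncomputable section

namespace Summit.PneNP.PneNP.Theorems.UniformStreamLB.Birth

namespace StreamLoop

open Literature.Computability.Complexity Literature.Computability.Complexity.TM2Comp
  Literature.Computability.Complexity.SpaceLoop Turing StateTransition Function

/-! ### Notation: counted runs through a predicate; good configurations -/

/-- `RunsIn⟪C, f, P, a, b, m⟫`: a run of `f` from `a` to `b` all of whose configurations satisfy `P`
(`SpaceLoop.RunsVia`) together with the step budget `m` (`TM2Iter.ReachesIn`). -/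
local notation "RunsIn⟪" C ", " f ", " P ", " a ", " b ", " m "⟫" =>
  (@SpaceLoop.RunsVia C f P a b ∧ @TM2Iter.ReachesIn C f a b m)

/-- `Gd⟪M, W, x⟫`: the good configurations for input `x` and work-space bound `W` — work space
`wsp ≤ W` and the read-only input invariant `reverse LEFT ++ IN = x`. -/
local notation "Gd⟪" M ", " W ", " x "⟫" => (fun c : Conf M =>
  wsp M c ≤ W ∧ List.reverse (TM2.Cfg.stk c (Sum.inr Aux.LEFT)) ++ TM2.Cfg.stk c (Sum.inr Aux.IN) = x)


/-! ### Phases of the streaming loop machine -/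

section Phases

variable (M : FinTM2) (eIn : M.Γ M.k₀ ≃ Bool) (eOut : M.Γ M.k₁ ≃ Bool) (P : Conf M → Prop) (v : M.σ)
  (p : Ph) (S : ∀ k, List (M.Γ k))

/-- `feed`: `TMP` is moved (reversed, written through `eIn.symm`) on top of the input stack `k₀`
of `M`, then the tag word of the phase is pushed and the machine jumps to the main label of `M`;
`|TMP| + 1` steps. [folklore] -/
theorem feed_runs (i lf : List Bool) : ∀ (t : List Bool) (S : ∀ k, List (M.Γ k)),
    (∀ t₁ t₂, t₁ ++ t₂ = t →
      P (conf M (some (Sum.inr Lbl.feed)) v p (update S M.k₀ (t₁.reverse.map eIn.symm ++ S M.k₀)) i lf t₂)) →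
    P (conf M (some (Sum.inl M.main)) v p
      (update S M.k₀ (p.tags.map eIn.symm ++ (t.reverse.map eIn.symm ++ S M.k₀))) i lf []) →
    RunsIn⟪Conf M, (streamTM M eIn eOut).step, P, conf M (some (Sum.inr Lbl.feed)) v p S i lf t,
      conf M (some (Sum.inl M.main)) v p
        (update S M.k₀ (p.tags.map eIn.symm ++ (t.reverse.map eIn.symm ++ S M.k₀))) i lf [],
      t.length + 1⟫ := by
  intro t
  induction t with
  | nil =>
    intro S hP hend
    have h0 := hP [] [] rfl
    simp only [List.reverse_nil, List.map_nil, List.nil_append, update_eq_self, List.length_nil,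
      Nat.zero_add] at h0 hend ⊢
    exact rin_single (st_feed_nil M eIn eOut v p S i lf) h0 hend
  | cons s t ih =>
    intro S hP hend
    have h0 : P (conf M (some (Sum.inr Lbl.feed)) v p S i lf (s :: t)) := by
      simpa using hP [] (s :: t) rfl
    have h1 := ih (update S M.k₀ (eIn.symm s :: S M.k₀))
      (fun t₁ t₂ h => by
        have := hP (s :: t₁) t₂ (by simp [h])
        simp only [update_idem, update_self]
        simpa [List.append_assoc] using this)
      (by
        simp only [update_idem, update_self]
        simpa [List.append_assoc] using hend)
    simp only [update_idem, update_self] at h1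
    simpa [List.append_assoc] using
      rin_step_trans (st_feed_cons M eIn eOut v p S i lf t s) h0 h1

/-- `mv`: the output stack `k₁` of `M` is moved (reversed, read through `eOut`) onto `TMP`, then
the machine proceeds to `p.next`; `|k₁| + 1` steps. [folklore] -/
theorem mv_runs (i lf : List Bool) : ∀ (L : List (M.Γ M.k₁)) (t : List Bool),
    (∀ L₁ L₂, L₁ ++ L₂ = L →
      P (conf M (some (Sum.inr Lbl.mv)) v p (update S M.k₁ L₂) i lf (L₁.reverse.map eOut ++ t))) →
    P (conf M (some (Sum.inr p.next)) v p (update S M.k₁ []) i lf (L.reverse.map eOut ++ t)) →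
    RunsIn⟪Conf M, (streamTM M eIn eOut).step, P,
      conf M (some (Sum.inr Lbl.mv)) v p (update S M.k₁ L) i lf t,
      conf M (some (Sum.inr p.next)) v p (update S M.k₁ []) i lf (L.reverse.map eOut ++ t),
      L.length + 1⟫ := by
  intro L
  induction L with
  | nil =>
    intro t hP hend
    simpa using rin_single (st_mv_nil M eIn eOut v p S i lf t) (by simpa using hP [] [] rfl)
      (by simpa using hend)
  | cons g L ih =>
    intro t hP hend
    have h0 : P (conf M (some (Sum.inr Lbl.mv)) v p (update S M.k₁ (g :: L)) i lf t) := by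
      simpa using hP [] (g :: L) rfl
    have h1 := ih (eOut g :: t)
      (fun L₁ L₂ h => by simpa [List.append_assoc] using hP (g :: L₁) L₂ (by simp [h]))
      (by simpa [List.append_assoc] using hend)
    simpa [List.append_assoc] using
      rin_step_trans (st_mv_cons M eIn eOut v p S i lf t g L) h0 h1

/-- `rew`: `LEFT` is poured back onto `IN`, then the phase becomes `init` and the machine proceeds
to `feed`; `|LEFT| + 1` steps. [folklore] -/
theorem rew_runs (t : List Bool) : ∀ (lf i : List Bool),
    (∀ l₁ l₂, l₁ ++ l₂ = lf → P (conf M (some (Sum.inr Lbl.rew)) v p S (l₁.reverse ++ i) l₂ t)) →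
    P (conf M (some (Sum.inr Lbl.feed)) v Ph.init S (lf.reverse ++ i) [] t) →
    RunsIn⟪Conf M, (streamTM M eIn eOut).step, P, conf M (some (Sum.inr Lbl.rew)) v p S i lf t,
      conf M (some (Sum.inr Lbl.feed)) v Ph.init S (lf.reverse ++ i) [] t, lf.length + 1⟫ := by
  intro lf
  induction lf with
  | nil =>
    intro i hP hend
    simpa using rin_single (st_rew_nil M eIn eOut v p S i t) (by simpa using hP [] [] rfl)
      (by simpa using hend)
  | cons a lf ih =>
    intro i hP hend
    have h0 : P (conf M (some (Sum.inr Lbl.rew)) v p S i (a :: lf) t) := by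
      simpa using hP [] (a :: lf) rfl
    have h1 := ih (a :: i)
      (fun l₁ l₂ h => by simpa [List.append_assoc] using hP (a :: l₁) l₂ (by simp [h]))
      (by simpa [List.append_assoc] using hend)
    simpa [List.append_assoc] using
      rin_step_trans (st_rew_cons M eIn eOut v p S i lf t a) h0 h1

/-- **A run of the round machine** `M` is a run of the streaming loop machine on embedded
configurations, inside `P` if all embedded intermediate configurations are (same number of
steps). [folklore] -/
theorem embM_runs {n : ℕ} {a b : M.Cfg} (h : (flip bind M.step)^[n] (some a) = some b) (p : Ph)
    (i lf : List Bool)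
    (hP : ∀ j ≤ n, ∀ d, (flip bind M.step)^[j] (some a) = some d → P (embM d p i lf)) :
    RunsIn⟪Conf M, (streamTM M eIn eOut).step, P, embM a p i lf, embM b p i lf, n⟫ := by
  have H : ∀ c d, M.step c = some d →
      (streamTM M eIn eOut).step (embM c p i lf) = some (embM d p i lf) :=
    fun c d hcd => st_embM M eIn eOut c d hcd p i lf
  refine ⟨⟨n, iterate_bind_map M.step (streamTM M eIn eOut).step (fun c => embM c p i lf) H n a b h,
    fun j hj c hc => ?_⟩,
    ⟨n, le_rfl, iterate_bind_map M.step (streamTM M eIn eOut).step (fun c => embM c p i lf) H n a b h⟩⟩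
  obtain ⟨d, hd⟩ := exists_iterate_of_le h hj
  have := iterate_bind_map M.step (streamTM M eIn eOut).step (fun c => embM c p i lf) H j a d hd
  have e : some (embM d p i lf) = some c := this.symm.trans hc
  obtain rfl := Option.some.inj e
  exact hP j hj d hd

/-- **One round, continuing** (phase `p ≠ accept`). With the payload `w` reversed on `TMP`, from
`feed` the machine feeds `M` the word `u = p.tags ++ w`; if `M` maps `u` to `w'` in `n` steps
(`initList` to `haltList`), the machine arrives at the label `p.next` with `w'` reversed on `TMP`
and all stacks of `M` empty, within `|w| + |w'| + n + 3` steps, inside `P` if the displayed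
intermediate configurations are. [folklore] -/
theorem round_runs (hp : p ≠ Ph.accept) (i lf w w' u : List Bool) (hu : p.tags ++ w = u) {n m : ℕ}
    (hrun : (flip bind M.step)^[n] (some (initList M (u.map eIn.symm))) =
      some (haltList M (w'.map eOut.symm)))
    (hP_feed : ∀ t₁ t₂, t₁ ++ t₂ = w.reverse →
      P (conf M (some (Sum.inr Lbl.feed)) M.initialState p
        (update (botStk M) M.k₀ (t₁.reverse.map eIn.symm)) i lf t₂))
    (hP_M : ∀ j ≤ n, ∀ d, (flip bind M.step)^[j] (some (initList M (u.map eIn.symm))) = some d →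
      P (embM d p i lf))
    (hP_mv : ∀ L₁ L₂, L₁ ++ L₂ = w'.map eOut.symm →
      P (conf M (some (Sum.inr Lbl.mv)) M.initialState p (update (botStk M) M.k₁ L₂) i lf
        (L₁.reverse.map eOut)))
    (hP_end : P (conf M (some (Sum.inr p.next)) M.initialState p (botStk M) i lf w'.reverse))
    (hm : w.length + w'.length + n + 3 ≤ m) :
    RunsIn⟪Conf M, (streamTM M eIn eOut).step, P,
      conf M (some (Sum.inr Lbl.feed)) M.initialState p (botStk M) i lf w.reverse,
      conf M (some (Sum.inr p.next)) M.initialState p (botStk M) i lf w'.reverse, m⟫ := by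
  subst hu
  -- `feed`
  have hstart : embM (initList M ((p.tags ++ w).map eIn.symm)) p i lf =
      conf M (some (Sum.inl M.main)) M.initialState p
        (update (botStk M) M.k₀ (p.tags.map eIn.symm ++
          (w.reverse.reverse.map eIn.symm ++ botStk M M.k₀))) i lf [] := by
    rw [embM_initList]; simp
  have h1 := feed_runs M eIn eOut P M.initialState p i lf w.reverse (botStk M)
    (fun t₁ t₂ h => by simpa using hP_feed t₁ t₂ h)
    (by rw [← hstart]; exact hP_M 0 (Nat.zero_le _) _ rfl)
  rw [← hstart] at h1
  -- the run of `M`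
  have h2 := embM_runs M eIn eOut P hrun p i lf hP_M
  rw [embM_haltList] at h2
  -- `ret`
  have e3 := st_ret_of_ne M eIn eOut M.initialState p (update (botStk M) M.k₁ (w'.map eOut.symm))
    i lf [] hp
  -- `mv`
  have h4 := mv_runs M eIn eOut P M.initialState p (botStk M) i lf (w'.map eOut.symm) []
    (fun L₁ L₂ h => by simpa using hP_mv L₁ L₂ h)
    (by simpa [update_botStk_nil, List.map_reverse] using hP_end)
  have h34 := rin_step_trans e3 h2.1.last h4
  simp only [update_botStk_nil, List.append_nil, map_reverse_map_symm, List.length_map] at h34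
  refine rin_mono (rin_trans (rin_trans h1 h2) h34) ?_
  simp only [List.length_reverse]
  omega

/-- **The accepting round.** With the final state `w` reversed on `TMP`, from `feed` in phase
`accept` the machine feeds `M` the word `u = 11w`; if `M` maps `u` to the one-symbol verdict `[a]`
in `n` steps, the machine halts with `[a]` on the output stack `k₁` of `M`, within `|w| + n + 2`
steps, inside `P` if the displayed intermediate configurations are. [folklore] -/
theorem accept_runs (i lf w u : List Bool) (hu : Ph.accept.tags ++ w = u) (a : Bool) {n m : ℕ}
    (hrun : (flip bind M.step)^[n] (some (initList M (u.map eIn.symm))) =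
      some (haltList M ([a].map eOut.symm)))
    (hP_feed : ∀ t₁ t₂, t₁ ++ t₂ = w.reverse →
      P (conf M (some (Sum.inr Lbl.feed)) M.initialState Ph.accept
        (update (botStk M) M.k₀ (t₁.reverse.map eIn.symm)) i lf t₂))
    (hP_M : ∀ j ≤ n, ∀ d, (flip bind M.step)^[j] (some (initList M (u.map eIn.symm))) = some d →
      P (embM d Ph.accept i lf))
    (hP_end : P ⟨none, (M.initialState, none, Ph.accept),
      mkStk (update (botStk M) M.k₁ [eOut.symm a]) i lf [] []⟩)
    (hm : w.length + n + 2 ≤ m) :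
    RunsIn⟪Conf M, (streamTM M eIn eOut).step, P,
      conf M (some (Sum.inr Lbl.feed)) M.initialState Ph.accept (botStk M) i lf w.reverse,
      (⟨none, (M.initialState, none, Ph.accept),
        mkStk (update (botStk M) M.k₁ [eOut.symm a]) i lf [] []⟩ : Conf M), m⟫ := by
  subst hu
  have hstart : embM (initList M ((Ph.accept.tags ++ w).map eIn.symm)) Ph.accept i lf =
      conf M (some (Sum.inl M.main)) M.initialState Ph.accept
        (update (botStk M) M.k₀ (Ph.accept.tags.map eIn.symm ++
          (w.reverse.reverse.map eIn.symm ++ botStk M M.k₀))) i lf [] := by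
    rw [embM_initList]; simp
  have h1 := feed_runs M eIn eOut P M.initialState Ph.accept i lf w.reverse (botStk M)
    (fun t₁ t₂ h => by simpa using hP_feed t₁ t₂ h)
    (by rw [← hstart]; exact hP_M 0 (Nat.zero_le _) _ rfl)
  rw [← hstart] at h1
  have h2 := embM_runs M eIn eOut P hrun Ph.accept i lf hP_M
  rw [embM_haltList] at h2
  simp only [List.map_cons, List.map_nil] at h2
  have e3 := st_ret_accept M eIn eOut M.initialState
    (mkStk (update (botStk M) M.k₁ [eOut.symm a]) i lf [] [])
  have h3 := rin_single e3 h2.1.last hP_end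
  refine rin_mono (rin_trans (rin_trans h1 h2) h3) ?_
  simp only [List.length_reverse]
  omega

end Phases

/-! ### The trajectory on the data of the stub, 1: embedded runs, the counting phase -/

section Specific

/-- A halting computation in Mathlib's `initList`/`haltList` form takes at least one step (the two
configurations have different labels). [folklore] -/
theorem pos_of_outputsWithin {Mx : TM2ComputableAux Bool Bool} {l l' : List Bool} {m : ℕ}
    (h : Mx.OutputsWithin l l' m) : 1 ≤ m := by
  obtain ⟨n, hn, e⟩ := TM2Iter.reachesIn_of_outputsWithin Mx h
  cases n with
  | zero =>
    have := congrArg TM2.Cfg.l (Option.some.inj e)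
    simp [initList, haltList] at this
  | succ n => omega

/-- Iterating a length-preserving-bound update keeps the bound. [folklore] -/
theorem length_foldl_le {upd : ℕ → List Bool → Bool → List Bool} {S : ℕ → ℕ} (N : ℕ)
    (hupdS : ∀ (st : List Bool) (b : Bool), st.length ≤ S N → (upd N st b).length ≤ S N) :
    ∀ (l st : List Bool), st.length ≤ S N → (l.foldl (upd N) st).length ≤ S N
  | [], _, h => h
  | b :: l, st, h => length_foldl_le N hupdS l (upd N st b) (hupdS st b h)

variable (Mx : TM2ComputableAux Bool Bool)

/-- **An embedded run of the round machine is good.** A computation of `Mx` on a word `u` of length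
`≤ B N + 3` within `B N` steps, embedded with `reverse lf ++ i = x`, passes only through good
configurations. [cite: AroraBarak2009, Thm. 4.2 (a time-T computation touches O(T) cells)] -/
theorem gd_run {B : ℕ → ℕ} {N : ℕ} {u w : List Bool} (h : Mx.OutputsWithin u w (B N))
    (hu : u.length ≤ B N + 3) (x i lf : List Bool) (hx : lf.reverse ++ i = x) (p : Ph) :
    ∃ n ≤ B N, (flip bind Mx.tm.step)^[n] (some (initList Mx.tm (u.map Mx.inputAlphabet.symm))) =
        some (haltList Mx.tm (w.map Mx.outputAlphabet.symm)) ∧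
      ∀ j ≤ n, ∀ d, (flip bind Mx.tm.step)^[j] (some (initList Mx.tm (u.map Mx.inputAlphabet.symm))) =
        some d → Gd⟪Mx.tm, Wb Mx B N, x⟫ (embM d p i lf) := by
  obtain ⟨n, hn, e⟩ := TM2Iter.reachesIn_of_outputsWithin Mx h
  refine ⟨n, hn, e, fun j hj d hd => gd_embM Mx.tm ?_ hx⟩
  have h1 := stkLen_le_of_iterate Mx.tm hd
  rw [stkLen_initList, List.length_map] at h1
  have h2 : nStk Mx.tm * machinePushBound Mx.tm * j ≤ nStk Mx.tm * machinePushBound Mx.tm * B N :=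
    Nat.mul_le_mul_left _ (hj.trans hn)
  unfold Wb
  omega

variable (cnt ini : ℕ → List Bool) (upd : ℕ → List Bool → Bool → List Bool)
  (acc : ℕ → List Bool → Bool) (S B : ℕ → ℕ)

/-- **One counting round.** [folklore] -/
theorem count_round (hcntB : ∀ N n : ℕ, n ≤ N → (cnt n).length ≤ B N)
    (hcntRun : ∀ N n : ℕ, n < N → Mx.OutputsWithin (false :: false :: cnt n) (cnt (n + 1)) (B N))
    (x i₁ i₂ : List Bool) (a : Bool) (hx : i₁ ++ a :: i₂ = x) :
    RunsIn⟪Conf Mx.tm, (streamTM Mx.tm Mx.inputAlphabet Mx.outputAlphabet).step,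
      Gd⟪Mx.tm, Wb Mx B x.length, x⟫,
      conf Mx.tm (some (Sum.inr Lbl.cnt)) Mx.tm.initialState Ph.count (botStk Mx.tm) (a :: i₂)
        i₁.reverse (cnt i₁.length).reverse,
      conf Mx.tm (some (Sum.inr Lbl.cnt)) Mx.tm.initialState Ph.count (botStk Mx.tm) i₂
        (a :: i₁.reverse) (cnt (i₁.length + 1)).reverse,
      3 * B x.length + 4⟫ := by
  have hn : i₁.length < x.length := by rw [← hx]; simp
  have hW := le_Wb Mx B x.length
  have hl0 := hcntB x.length i₁.length hn.le
  have hl1 := hcntB x.length (i₁.length + 1) hn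
  obtain ⟨n, hnB, hrun, hgd⟩ := gd_run Mx (hcntRun x.length i₁.length hn) (by simp; omega) x i₂
    (a :: i₁.reverse) (by simp [← hx]) Ph.count
  have e0 := st_cnt_cons Mx.tm Mx.inputAlphabet Mx.outputAlphabet Mx.tm.initialState Ph.count
    (botStk Mx.tm) i₂ i₁.reverse (cnt i₁.length).reverse a
  have hr := round_runs Mx.tm Mx.inputAlphabet Mx.outputAlphabet Gd⟪Mx.tm, Wb Mx B x.length, x⟫
    Ph.count (by intro h; cases h) i₂ (a :: i₁.reverse) (cnt i₁.length) (cnt (i₁.length + 1))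
    (false :: false :: cnt i₁.length) rfl (m := 3 * B x.length + 3) hrun
    (fun t₁ t₂ h => gd_conf Mx.tm
      (by have := congrArg List.length h; simp at this ⊢; omega) (by simp [← hx]))
    hgd
    (fun L₁ L₂ h => gd_conf Mx.tm
      (by have := congrArg List.length h; simp at this ⊢; omega) (by simp [← hx]))
    (gd_conf Mx.tm (by simp; omega) (by simp [← hx]))
    (by omega)
  exact rin_mono (rin_step_trans (P := Gd⟪Mx.tm, Wb Mx B x.length, x⟫) e0
    (gd_conf Mx.tm (by simp; omega) (by simp [← hx])) hr) (by omega)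

/-- **The counting phase**: one counting round per remaining input symbol, then `cnt` finds the
input exhausted and goes to `rew`. [folklore] -/
theorem count_phase (hcntB : ∀ N n : ℕ, n ≤ N → (cnt n).length ≤ B N)
    (hcntRun : ∀ N n : ℕ, n < N → Mx.OutputsWithin (false :: false :: cnt n) (cnt (n + 1)) (B N))
    (x : List Bool) : ∀ (i₂ i₁ : List Bool), i₁ ++ i₂ = x →
    RunsIn⟪Conf Mx.tm, (streamTM Mx.tm Mx.inputAlphabet Mx.outputAlphabet).step,
      Gd⟪Mx.tm, Wb Mx B x.length, x⟫,
      conf Mx.tm (some (Sum.inr Lbl.cnt)) Mx.tm.initialState Ph.count (botStk Mx.tm) i₂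
        i₁.reverse (cnt i₁.length).reverse,
      conf Mx.tm (some (Sum.inr Lbl.rew)) Mx.tm.initialState Ph.count (botStk Mx.tm) []
        x.reverse (cnt x.length).reverse,
      i₂.length * (3 * B x.length + 4) + 1⟫
  | [], i₁, hx => by
    rw [List.append_nil] at hx
    subst hx
    have hW := le_Wb Mx B i₁.length
    have hl := hcntB i₁.length i₁.length le_rfl
    simpa using rin_single (P := Gd⟪Mx.tm, Wb Mx B i₁.length, i₁⟫)
      (st_cnt_nil Mx.tm Mx.inputAlphabet Mx.outputAlphabet
        Mx.tm.initialState Ph.count (botStk Mx.tm) i₁.reverse (cnt i₁.length).reverse)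
      (gd_conf Mx.tm (by simp; omega) (by simp)) (gd_conf Mx.tm (by simp; omega) (by simp))
  | a :: i₂, i₁, hx => by
    have h1 := count_round Mx cnt B hcntB hcntRun x i₁ i₂ a hx
    have h2 := count_phase hcntB hcntRun x i₂ (i₁ ++ [a]) (by simpa using hx)
    rw [show (i₁ ++ [a]).reverse = a :: i₁.reverse by simp,
      show (i₁ ++ [a]).length = i₁.length + 1 by simp] at h2
    refine rin_mono (rin_trans h1 h2) (le_of_eq ?_)
    simp only [List.length_cons]
    ring

end Specific

end StreamLoop

/-- **Registered sub-goal `stub_streamLoop_part3` (part 3 of the proof of `stub_streamLoop`): the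
counting phase.** From its initial configuration on `x` the streaming loop machine reaches the
rewinding label with the counter word `cnt |x|` reversed on `TMP` and the whole input on `LEFT`,
within `|x| · (3 B |x| + 4) + 1` steps. [folklore] -/
theorem stub_streamLoop_part3 :
    ∀ (M : Turing.TM2ComputableAux Bool Bool) (cnt : ℕ → List Bool) (B : ℕ → ℕ),
      cnt 0 = [] →
      (∀ N n : ℕ, n ≤ N → (cnt n).length ≤ B N) →
      (∀ N n : ℕ, n < N → M.OutputsWithin (false :: false :: cnt n) (cnt (n + 1)) (B N)) →
      ∀ x : List Bool, Literature.Computability.Complexity.TM2Iter.ReachesIn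
        (StreamLoop.streamTM M.tm M.inputAlphabet M.outputAlphabet).step
        ((StreamLoop.streamSM M.tm M.inputAlphabet M.outputAlphabet).init x)
        (StreamLoop.conf M.tm (some (Sum.inr StreamLoop.Lbl.rew)) M.tm.initialState
          StreamLoop.Ph.count (Literature.Computability.Complexity.SpaceLoop.botStk M.tm) []
          x.reverse (cnt x.length).reverse)
        (x.length * (3 * B x.length + 4) + 1) := by
  intro M cnt B hcnt0 hcntB hcntRun x
  have h := (StreamLoop.count_phase M cnt B hcntB hcntRun x x [] rfl).2
  rw [List.reverse_nil, List.length_nil, hcnt0, List.reverse_nil] at h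
  rw [StreamLoop.streamSM_init]
  exact h

end Summit.PneNP.PneNP.Theorems.UniformStreamLB.Birth
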